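import Summits.QuantumFields.YangMills.Theorems.UnitScaleTiltProp7SectET3CurvedPropagatorsT3
import HarnessLib

/-!
# Route `UnitScaleTilt`, crux «MinimiserStabilityRegPr» (stmt-QuantumFields-19200, stub EX) ∕ (O″χ) B0 (stmt-QuantumFields-20520), node N06(d = 3), route (α) —
# LAYER 0, ROWS OF BRICK L0d (def-free sibling of `UnitScaleTiltProp7SectET3CurvedPropagatorsT3`, ★★OWNER ACK 32 (q3)), PART 1: **THE CONSTRAINT ROWS (45)∕(129) OF THE
# EX KNIT ON THE ROUTE CARRIERS, FOR THE LAYER-0 LETTERS, ON THE CLASS `PosOnto`** — `QTwS U₀ (Hf Y) = Y` (= the first member of `h46tw`'s (45) «`LʲηQ_jHB = B`») and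
# `QTwS U₀ (ι(H₁f B)) = η⁻¹ • B` (= `h129` verbatim) for the averaging of record `QTwS` (i.e. AFTER the def-swap `QTw → QTwS` of RULING g26-№12; the displayed v2.5 rows still read `QTw`)

Cell `ym-inputs` (desk `pub/ym-inputs`, INPUT-LIST.md v6 §4 row p01; memo `pub/ym-inputs/DEFINER-MEMO-T3.md` §2 L0e).  THEOREMS ONLY (0 `def`, 0 `sorry`); `--supports stmt-QuantumFields-20520
--as helper`; count-neutral.  YM₃ on T³ is ladder rung R3, NOT the Clay problem; nothing here is a claim about a stub, a crux, d = 4 or the mass gap.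

THE PRINT.  [Balaban1985Variational] (45) p. 285: *«L^jηQ_jHB = B on Λ_j»*; (103) p. 293 `A′ = A₁ + H₁B`; (129) p. 297 (the `H₁`-row of the datum split).  [Balaban1985BackgroundPropagators]
(3.110) p. 417 *«In the future we will write the first condition in (3.110) as Q(U)A = B»*, (3.126) p. 420, (3.129) p. 421.

WHAT IS PROVED (member `F`, `h : n ≤ K`, parameters `c₀ cB a`, Hessian letter `Δx`; hypothesis `hp : PosOnto … Δx U₀` = [B9] Thm 3.11 positivity + `Q` onto, DISPLAYED):
* `QTwS_toL2_symm` — the averaging of record read through brick L0a's transports: `QTwS U₀ (toL2⁻¹ x) = toL2B⁻¹ (QL2 U₀ x)`;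
* `QL2_eq_inv_smul_Qk` — `QL2 = η⁻¹ • Q_k` (A-units vs exponent units, `η ≠ 0` from `1 < L`);
* ★★ **`QTwS_Hf`** — `QTwS F n K h U₀ (Hf … U₀ Y) = Y` for every block field `Y` ON THE CLASS: the (45)∕«`QTw∘H = id`» member of the EX binder `h46tw`
  (`Prop7StubEXOfChartPiecesTwL.lean:152`) for the layer-0 letter `H := Hf` and the averaging of record;
* `iota_H1f_eq` — the EX knit's reading `b ↦ JetSup.equiv (H₁f B) (bondEquiv F K b)` of the (115)-valued letter IS `toL2⁻¹ (HT (toL2B B))`;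
* ★★ **`QTwS_iota_H1f`** — `QTwS F n K h U₀ (fun b ↦ JetSup.equiv _ _ _ (H1f … U₀ B) (bondEquiv F K b)) = fun c ↦ (η : ℂ)⁻¹ • B c` ON THE CLASS: the EX binder `h129`
  (`…StubEXOfChartPiecesTwL.lean:173–176`) VERBATIM for the layer-0 letter `H₁f := H1f` and the averaging of record.
So, once (i) the def-swap v2.6ˢ displays `QTwS` and (ii) the N06 input «`RegPr … (α L) U₀ → PosOnto … U₀`» (Thm 3.11 + `Q` onto on the regular class) is supplied, `h129` and the first
member of `h46tw` close BY `exact` at `𝒢f∕H₁f∕H := frakGf∕H1f∕Hf` — as ★w1-20520 g4's HANDOFF (iii) anticipated.  The Landau members (`h102L`∕`h129L`∕(45)₂) and `h102` need the (3.124)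
rows (brick L0e part 2, `B6Eq231` mechanism on L0c's `QL2_DL2_of_RS_eq`) and the Hessian letter's gauge invariance on `N_S` (brick L0b's `Δ_π`).
HONEST SCOPE.  Algebra on the class `PosOnto`; no estimate; positivity NOT proved; nothing of print asserted.

References: T. Bałaban, CMP **102** (1985) 277–309 [Balaban1985Variational] ((45) p.285, (103) p.293, (129) p.297); CMP **99** (1985) 389–434 [Balaban1985BackgroundPropagators]
((3.110) p.417, (3.126) p.420, (3.129) p.421).
-/

set_option autoImplicit false

noncomputable section

open scoped InnerProductSpace ComplexConjugate Matrix.Norms.L2Operator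

namespace Summit.QuantumFields.YangMills.Theorems.Prop7SectET3CurvedPropagators

open Literature.MathematicalPhysics.QuantumFieldTheory.Balaban1983to89
open Literature.MathematicalPhysics.QuantumFieldTheory.Balaban1983to89.T3ContinuumYM3Torus
open T3SectALandauChart (eta eta_pos)
open B9SectCLatticeCarrier (Bond)
open B9Eq311L2Pairing (WL2)
open B11Eq115Space (NegSize Space115 JetSup NegSup)
open B11Eq103H1Complex (SiteL2K BondL2K)
open Summit.QuantumFields.YangMills.Theorems.Prop7SectET3Transport (periodsT3 bondEquiv bgOfCfg)
open Summit.QuantumFields.YangMills.Theorems.Prop7SectET3HilbertLetters (W₂ frobEquiv toL2 toL2B QL2 QL2_toL2 toL2_symm_apply)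
open Summit.QuantumFields.YangMills.Theorems.Prop7SymAvgTwSym (QTwS)

variable {F : T3Family} {n K : ℕ} {h : n ≤ K} {c₀ cB a : ℝ} [Fact (0 < c₀)] [Fact (0 < cB)]
  {Δx : GaugeField (F.P K) 0 (Matrix.specialUnitaryGroup (Fin 2) ℂ) → (BondL2K ℂ 3 (periodsT3 F K) c₀ W₂ →ₗ[ℂ] BondL2K ℂ 3 (periodsT3 F K) c₀ W₂)}

omit [Fact (0 < c₀)] [Fact (0 < cB)] in
/-- The averaging of record read through the `L²` transports: `QTwS U₀ (toL2⁻¹ x) = toL2B⁻¹ (QL2 U₀ x)` (brick L0a's `QL2_toL2` turned around).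
[cite: Balaban1985BackgroundPropagators, (3.14) p.393] -/
theorem QTwS_toL2_symm (U₀ : GaugeField (F.P K) 0 (Matrix.specialUnitaryGroup (Fin 2) ℂ)) (x : BondL2K ℂ 3 (periodsT3 F K) c₀ W₂) :
    QTwS F n K h U₀ ((toL2 F K c₀).symm x) = (toL2B F n cB).symm (QL2 F n K h c₀ cB U₀ x : WL2 ℂ (fun _ : PBond (F.P n) 0 => cB) W₂) := by
  have hx := QL2_toL2 (c₀ := c₀) (cB := cB) (h := h) U₀ ((toL2 F K c₀).symm x)
  rw [LinearEquiv.apply_symm_apply] at hx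
  rw [hx, LinearEquiv.symm_apply_apply]

omit [Fact (0 < c₀)] [Fact (0 < cB)] in
/-- `η ≠ 0` at every member (`η = L^{−(K−n)}`, `1 < L`). [cite: Balaban1985Variational, (15) p.280] -/
theorem eta_cast_ne_zero : (((eta F n K : ℝ) : ℂ)) ≠ 0 := by
  exact_mod_cast (eta_pos F n K).ne'

omit [Fact (0 < c₀)] [Fact (0 < cB)] in
/-- A-units vs exponent units: `QL2 U₀ x = η⁻¹ • Q_k(U₀) x`. [cite: Balaban1985Variational, (44) p.285] -/
theorem QL2_eq_inv_smul_Qk (U₀ : GaugeField (F.P K) 0 (Matrix.specialUnitaryGroup (Fin 2) ℂ)) (x : BondL2K ℂ 3 (periodsT3 F K) c₀ W₂) :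
    QL2 F n K h c₀ cB U₀ x = (((eta F n K : ℝ) : ℂ))⁻¹ • Qk F n K h c₀ cB U₀ x := by
  rw [Qk, LinearMap.smul_apply, inv_smul_smul₀ eta_cast_ne_zero]

/-- ★★ **(45)∕«`QTw ∘ H = id`» FOR THE LAYER-0 LETTER ON THE CLASS: `QTwS U₀ (Hf Y) = Y`** — the first member of the EX binder `h46tw` for `H := Hf` and the averaging of record, from
lit-balaban's `Q_H1LatticeK` (`Qk_HT`) through the transports. [cite: Balaban1985Variational, (45) p.285; Balaban1985BackgroundPropagators, (3.126) p.420] -/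
theorem QTwS_Hf {U₀ : GaugeField (F.P K) 0 (Matrix.specialUnitaryGroup (Fin 2) ℂ)} (hp : PosOnto F n K h c₀ cB a Δx U₀) (Y : PBond (F.P n) 0 → Matrix (Fin 2) (Fin 2) ℂ) :
    QTwS F n K h U₀ (Hf F n K h c₀ cB a Δx U₀ Y) = Y := by
  rw [Hf_apply, map_smul, QTwS_toL2_symm, QL2_eq_inv_smul_Qk, Qk_HT hp, map_smul, smul_inv_smul₀ eta_cast_ne_zero, LinearEquiv.symm_apply_apply]

/-- The EX knit's reading of the (115)-valued letter on the route carriers, `b ↦ ι(H₁f B)(bondEquiv b)`, IS `toL2⁻¹ (H (toL2B B))`. [cite: Balaban1985Variational, (103) p.293] -/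
theorem iota_H1f_eq [Fact (0 < (F.L : ℝ))] [Fact (0 < ((F.L : ℝ)⁻¹) ^ (K - n))] (U₀ : GaugeField (F.P K) 0 (Matrix.specialUnitaryGroup (Fin 2) ℂ))
    (B : PBond (F.P n) 0 → Matrix (Fin 2) (Fin 2) ℂ) :
    (fun b : PBond (F.P K) 0 => JetSup.equiv _ _ _ (H1f F n K h c₀ cB a Δx U₀ B) (bondEquiv F K b)) = (toL2 F K c₀).symm (HT F n K h c₀ cB a Δx U₀ (toL2B F n cB B)) := by
  funext b
  rw [H1f_apply, toL2_symm_apply]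

/-- ★★ **THE EX BINDER `h129` VERBATIM FOR THE LAYER-0 LETTER ON THE CLASS: `QTwS U₀ (ι(H₁f B)) = η⁻¹ • B`** (print's `Q(H₁B) = B`, (45)∕(3.129), in the exponent-scale currency of the route's
`QTwS`). [cite: Balaban1985Variational, (45) p.285, (129) p.297; Balaban1985BackgroundPropagators, (3.129) p.421] -/
theorem QTwS_iota_H1f [Fact (0 < (F.L : ℝ))] [Fact (0 < ((F.L : ℝ)⁻¹) ^ (K - n))] {U₀ : GaugeField (F.P K) 0 (Matrix.specialUnitaryGroup (Fin 2) ℂ)}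
    (hp : PosOnto F n K h c₀ cB a Δx U₀) (B : PBond (F.P n) 0 → Matrix (Fin 2) (Fin 2) ℂ) :
    QTwS F n K h U₀ (fun b : PBond (F.P K) 0 => JetSup.equiv _ _ _ (H1f F n K h c₀ cB a Δx U₀ B) (bondEquiv F K b)) =
      fun c => (((eta F n K : ℝ) : ℂ))⁻¹ • B c := by
  rw [iota_H1f_eq, QTwS_toL2_symm, QL2_eq_inv_smul_Qk, Qk_HT hp, map_smul, LinearEquiv.symm_apply_apply]
  rfl

/-- Off the class the letter `Hf` is `0` (junk value; the EX rows are asked only under `RegPr`, where the class holds by the N06 input). [folklore] -/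
theorem Hf_of_not {U₀ : GaugeField (F.P K) 0 (Matrix.specialUnitaryGroup (Fin 2) ℂ)} (hp : ¬ PosOnto F n K h c₀ cB a Δx U₀) : Hf F n K h c₀ cB a Δx U₀ = 0 := by
  apply LinearMap.ext
  intro Y
  rw [Hf_apply, HT_of_not hp, LinearMap.zero_apply, map_zero, smul_zero, LinearMap.zero_apply]

end Summit.QuantumFields.YangMills.Theorems.Prop7SectET3CurvedPropagators

end
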